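import Summits.Langlands.Langlands.Theses.IrreducibilityBySelfDuality
import Literature.NumberTheory.Automorphic.SelfdualGL3AdjointLiftProofs
import Literature.NumberTheory.Automorphic.ReciprocityGLnRankOneProofs
import Literature.NumberTheory.Automorphic.GLOneArchParameterOfAlgebraicCharacter
import Literature.NumberTheory.Automorphic.BaseChangeArchimedeanCentralCharacter
import Literature.NumberTheory.Automorphic.ClozelAlgebraicity
import Summits.Langlands.Langlands.Theorems.IrreducibilityBySelfDualityRegularAdjointLiftCMCentralCharacterInfinityType
import Summits.Langlands.Langlands.Theorems.IrreducibilityBySelfDualityRegularAdjointLiftCMCubeRootAlgebraic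
import Summits.Langlands.Langlands.Theorems.IrreducibilityBySelfDualityRegularAdjointLiftCMHermitianSymmetry

/-!
# Line `nu-cubed-central-character` for the crux `RegularAdjointLiftCM` (stmt-Langlands-13617):
# the composition `RegularTwistCM → RegularAdjointLiftCM`, all three stubs LANDED

STATE (line lead `prover-line-stmt-Langlands-13617-0`, 2026-08-16): the three registered stubs of the line are
landed theorems of the tree — `stub_centralCharacterInfinityType` (p76660,
`Theorems/IrreducibilityBySelfDualityRegularAdjointLiftCMCentralCharacterInfinityType.lean`), `stub_cubeRootAlgebraic`
(p77063, `…CubeRootAlgebraic.lean`), `stub_hermitianSymmetry` (p96466 `…HermitianSymmetry.lean`, re-exporting the Literature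
theorem (p78932) `CuspidalAutomorphicRepData.archParameter_conjugate_eq_map_neg_conj_add` of `ClozelPurityProofs`, which also
PROVES clause (iii) of `Clozel1990_regularAlgebraic` for every `n`) — so this file is sorry-free and
`RegularAdjointLiftCM_of : RegularTwistCM → RegularAdjointLiftCM` is an unconditional theorem of the tree: the crux is
CLOSED MODULO its sibling route item `RegularTwistCM` (stmt-Langlands-14069), by name (the standing Disproof §11
proves the converse direction modulo the inputs: the two cruxes are one problem).


Skeleton (crux-plan, round 1) of the idea card `Cruxes/RegularAdjointLiftCM/Ideas/nu-cubed-central-character.md`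
for the rank-2 crux `Summit.Langlands.Langlands.Theses.IrreducibilityBySelfDuality.RegularAdjointLiftCM` of
route `route-Langlands-IrreducibilityBySelfDuality`.

## The line in one paragraph

By the standing Disproof (`Cruxes/RegularAdjointLiftCM/Disproof.lean` §3, kernel-checked
`cmStep_of_regularTwistCM`), modulo the crux's own antecedent `SelfdualGL3AdjointLift` (Ramakrishnan 2014
Thm A at Satake level, INLINED in the crux) and the SIBLING crux `RegularTwistCM` (item stmt-Langlands-14069,
rank 3, separately staffed: a regular algebraic a.e. Satake twist of the `GL₂`-descent exists over a CM
field), the crux is EXACTLY the statement "`ν` is algebraic" (`NuAlgebraicInput`).  This line proves that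
statement — in the stronger any-field form `NuAlgebraic` (the card's Transfer `C⁺`) — through the CENTRE
only: (1) Satake half, PROVED below (`pow_three_eq_centralCharacter`): `Ad(β) = {b/b', b'/b, 1}` has
product `1`, so `∏ t_{π,v} = d_v³` a.e., and rigidity of Hecke characters gives `θ_ν³ = ω_π`;
(2) `stub_centralCharacterInfinityType`: the central character `ω_π` of ANY `π` with an infinity type `T`
whose `a`-sums are integers `A_ι` is an algebraic Hecke character of type `(-A_{ι_w}, -A_{ῑ_w})` (the centre
theorem `HasArchParameter.lieDeriv_scalar_sub_smul_mem` + `centralCharacter_det_ofInfinite_expGL`, the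
`GL₁` template being `exists_hasInfinityType_heckeCharacter_glOne`); (3) `stub_purityGL3`: Clozel's purity
on MULTISETS for cuspidal regular algebraic `π` on `GL₃` (clause (iii) of the named fact
`Clozel1990_regularAlgebraic` at `n = 3`; provable in the tree from the Petersson pairing via
`HasArchParameter.map_neg_conj_of_skewHermitian` — idea `petersson-hermitian-parity`), which makes
`3 ∣ p_w + q_w` for the type of `ω_π`; (4) `stub_cubeRootAlgebraic`: a cube root `χ` of an algebraic Hecke
character of type `(p, q)` with `3 ∣ p_w + q_w` everywhere is algebraic (`3 ∣ p_w - q_w` is automatic: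
evaluate at the idele `ζ₃` in the slot `w`; then `χ / A_{p/3,q/3}` is a continuous cube root of unity near
`1`).  Hence `θ_ν` is algebraic and the GL(1) datum `ν` is regular algebraic
(`exists_hasInfinityType_of_hasInfinityType_heckeCharacter_glOne`, assembled in
`isRegularAlgebraic_glOne_of_hasInfinityType` below).  The composition
`RegularAdjointLiftCM_of (hT : RegularTwistCM) : RegularAdjointLiftCM` is kernel-checked; its only
hypothesis is the sibling route item BY NAME; the three `stub_*` theorems are now discharged by the landed Theorems decls (no `sorry`).

## Reshape (line lead, 2026-08-16)

`stub_purityGL3` (Clozel purity at `n = 3`, regular algebraic) is RESHAPED into the registered analytic stub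
`stub_hermitianSymmetry` (all `n ≥ 1`, every cuspidal datum, no algebraicity: `χ(ῑ) = {-ā + c}` for one real
`c`) and the proved glue `purityGL3_of_hermitianSymmetry` (integrality of `GL₃` exponents pins `c ∈ ℤ`).
Registered stubs after the reshape: `stub_centralCharacterInfinityType`, `stub_cubeRootAlgebraic`,
`stub_hermitianSymmetry`.

## Disproof used

* honours §3 `NuAlgebraicInput` / `cmStep_of_regularTwistCM` (this file's `nuAlgebraicInput`,
  `RegularAdjointLiftCM_of` are that composition with `hN` DISCHARGED by the stubs);
* §3 `adRel_of_isSatakeTwistOf`, `nonDihedral_of_isSatakeTwistOf` are re-proved verbatim here (the Disproof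
  is a moving work file and is deliberately not imported);
* §4 `CMStepCAlgebraic` (regularity load-bearing) is respected: regularity of `π` enters `stub_purityGL3`
  (stated for REGULAR algebraic types, as the named fact is) — the cube arithmetic itself needs only
  `A_ι ∈ ℤ`; `IsCMField` is NOT used by this line (it is load-bearing in `RegularTwistCM` only, §4/§6);
* §5 (S1) "`ν` trivial" is not claimed (ν is algebraic of type `(A/3, B/3)`, in general of infinite order);
* landed Negative lemma `Theorems/RegularAdjointLiftCM/Negative/KillCriterion.lean`
  (`regularAdjointLiftCM_false_of_witness`, conditional on a CM witness believed not to exist): no stub below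
  is an instance it refutes (the stubs are GL(1)/centre statements, none asserts the crux's conclusion).

No new definitions are needed in Literature; the local `def`s below are verbatim names for the route text.
-/

open scoped BigOperators Topology Classical
open Filter Set Function IsDedekindDomain NumberField
open Literature.NumberTheory.Automorphic
open Literature.NumberTheory.GaloisRepresentations (HeckeCharacter ideleGroup)

set_option linter.dupNamespace false

noncomputable section

namespace Summit.Langlands.Langlands.Cruxes.RegularAdjointLiftCM.NuCubedCentralCharacter

open Summit.Langlands.Langlands.Theses.IrreducibilityBySelfDuality

/-! ## §0 Names for the route text (verbatim; all unfold definitionally to the crux's clauses) -/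

section Defs

variable {K : Type} [Field K] [NumberField K]

/-- The inlined quadratic sign `ε_{L/K}(v)` of the route text. -/
def quadSign (L : Type) [Field L] [NumberField L] [Algebra K L] (v : HeightOneSpectrum (𝓞 K)) : ℂ :=
  if ∃ w : HeightOneSpectrum (𝓞 L), w.asIdeal.under (𝓞 K) = v.asIdeal ∧ w.asIdeal.inertiaDeg (𝓞 K) = 1
  then (1 : ℂ) else -1

/-- `σ` is non-dihedral at Satake level (verbatim the route text). -/
def NonDihedral {h2 : isCompact_glFiniteIntegralLevel 2 K} (σ : CuspidalAutomorphicRepData 2 K h2) :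
    Prop :=
  ∀ (L : Type) [Field L] [NumberField L] [Algebra K L], Module.finrank K L = 2 →
    ¬ (∀ᶠ v in cofinite, ∀ β : Multiset ℂ, σ.1.HasSatakeParamAt v β →
        β.map (fun b => quadSign L v * b) = β)

/-- The adjoint relation at Satake level, `t_{π,v} = d_v · Ad(t_{σ,v})` a.e. (verbatim the route text, the
adjoint parameter INLINED as in the crux: `((β ×ˢ β).map (p ↦ p.1 p.2⁻¹)).erase 1 = adParams β`). -/
def AdRel {h3 : isCompact_glFiniteIntegralLevel 3 K} {h2 : isCompact_glFiniteIntegralLevel 2 K}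
    {h1 : isCompact_glFiniteIntegralLevel 1 K} (π : CuspidalAutomorphicRepData 3 K h3)
    (σ : CuspidalAutomorphicRepData 2 K h2) (ν : CuspidalAutomorphicRepData 1 K h1) : Prop :=
  ∀ᶠ v in cofinite, ∀ α β : Multiset ℂ, π.1.HasSatakeParamAt v α → σ.1.HasSatakeParamAt v β →
    ∃ d : ℂ, ν.1.HasSatakeParamAt v {d} ∧
      α = (((β ×ˢ β).map (fun p : ℂ × ℂ => p.1 * p.2⁻¹)).erase 1).map (fun c => d * c)

/-- `σ` is an a.e. Satake twist of `σ₀` by the GL(1) datum `χ` (verbatim the output clause of the sibling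
crux `RegularTwistCM`). -/
def IsSatakeTwistOf {h2 : isCompact_glFiniteIntegralLevel 2 K} {h1 : isCompact_glFiniteIntegralLevel 1 K}
    (σ σ₀ : CuspidalAutomorphicRepData 2 K h2) (χ : CuspidalAutomorphicRepData 1 K h1) : Prop :=
  ∀ᶠ v in cofinite, ∀ β : Multiset ℂ, σ₀.1.HasSatakeParamAt v β →
    ∃ c : ℂ, χ.1.HasSatakeParamAt v {c} ∧ σ.1.HasSatakeParamAt v (β.map (fun b => c * b))

end Defs

/-- **The target of the line, any-field form (the card's Transfer `C⁺`)**: if `π` on `GL₃` is regular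
algebraic and `t_π = ν · Ad(t_σ)` a.e., then the GL(1) datum `ν` is regular algebraic (= algebraic, type
`A₀`).  No `IsCMField`. -/
def NuAlgebraic : Prop :=
  ∀ (K : Type) [Field K] [NumberField K]
    (h1 : isCompact_glFiniteIntegralLevel 1 K) (h2 : isCompact_glFiniteIntegralLevel 2 K)
    (h3 : isCompact_glFiniteIntegralLevel 3 K) (π : CuspidalAutomorphicRepData 3 K h3)
    (σ : CuspidalAutomorphicRepData 2 K h2) (ν : CuspidalAutomorphicRepData 1 K h1),
    π.1.IsRegularAlgebraic → AdRel π σ ν → ν.1.IsRegularAlgebraic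

/-- The Disproof's residual input `NuAlgebraicInput` (§3), verbatim: the CM-field form of `NuAlgebraic`. -/
def NuAlgebraicInput : Prop :=
  ∀ (K : Type) [Field K] [NumberField K], IsCMField K →
    ∀ (h1 : isCompact_glFiniteIntegralLevel 1 K) (h2 : isCompact_glFiniteIntegralLevel 2 K)
      (h3 : isCompact_glFiniteIntegralLevel 3 K) (π : CuspidalAutomorphicRepData 3 K h3)
      (σ : CuspidalAutomorphicRepData 2 K h2) (ν : CuspidalAutomorphicRepData 1 K h1),
      π.1.IsRegularAlgebraic → AdRel π σ ν → ν.1.IsRegularAlgebraic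

theorem nuAlgebraicInput_of_nuAlgebraic (h : NuAlgebraic) : NuAlgebraicInput :=
  fun K _ _ _ h1 h2 h3 π σ ν hπ had => h K h1 h2 h3 π σ ν hπ had

/-! ## §1 The three stubs (registered; all three LANDED — discharged below by the tree's Theorems decls)

The statements of the stubs, as `Prop`s (for the hypothesis-form composition `nuAlgebraic_of`) and as the
sorried `stub_*` theorems (verbatim the same text). -/

/-- STATEMENT of `stub_centralCharacterInfinityType` — **the central character of a representation with an
infinity type whose `a`-sums are integral is an algebraic Hecke character of type `(-A_{ι_w}, -A_{ῑ_w})`**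
(at a real place `(-A_{ι_w}, 0)`).  For `π = W/W'` on `GL_n(𝔸_K)` (any `n`, any `K`, not necessarily
cuspidal), `ω` a Hecke character through which the centre acts (`AutomorphicRepData.exists_centralCharacter`),
`T` an infinity type of `π` with `∑ (a : T ι) = A ι ∈ ℤ`: `ω((x,1)) = ∏_w ι_w(x_w)^{A} \bar ι_w(x_w)^{B}` near
`1`.  Proof sketch: the central `x · 1_n ∈ 𝔤` acts by `s(x) = ∑_{w real} x_w A_{ι_w} + ∑_{w cx} (x_w A_{ι_w} +
x̄_w A_{ῑ_w})` (`HasArchParameter.lieDeriv_scalar_sub_smul_mem`), `ω(det(exp Y, 1)) = e^{s(Y)}`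
(`centralCharacter_det_ofInfinite_expGL`), and every totally positive infinite idele is `det(exp Y, 1)` for
the coordinatewise logarithm — word for word the `GL₁` proof `exists_hasInfinityType_heckeCharacter_glOne`
(ReciprocityGLnRankOneProofs) with `k σ` replaced by `A σ`.  Size M. -/
def CentralCharacterInfinityType : Prop :=
  ∀ (K : Type) [Field K] [NumberField K] (n : ℕ) (hcpt : isCompact_glFiniteIntegralLevel n K)
    (π : AutomorphicRepData (AutomorphyDatum.gl n K hcpt)) (ω : HeckeCharacter K),
    (∀ (z : ideleGroup K), ∀ φ ∈ π.W, rightTranslation (AdelicGroupData.gl n K)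
        (Matrix.GeneralLinearGroup.scalar (Fin n) z) φ - ((ω z : ℂˣ) : ℂ) • φ ∈ π.W') →
    ∀ (T : InfinityType K n), π.HasInfinityType T →
    ∀ (A : (K →+* ℂ) → ℤ), (∀ ι : K →+* ℂ, ((T ι).map ArchWeight.a).sum = (A ι : ℂ)) →
      ω.HasInfinityType (fun w => -A w.embedding)
        (fun w => if w.IsReal then 0 else -A (ComplexEmbedding.conjugate w.embedding))

/-- STATEMENT of `stub_cubeRootAlgebraic` — **a cube root of an algebraic Hecke character of weight
divisible by `3` is algebraic**: if `χ³ = ω`, `ω` has infinity type `(p, q)` and `3 ∣ p_w + q_w` at every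
infinite place, then `χ` is algebraic (of type `(p/3, q/3)` at complex places, `((p+q)/3, 0)` at real ones).
Proof sketch: at a complex `w`, `ω_w(z) = ι_w(z)^{-p_w} \bar ι_w(z)^{-q_w}` for ALL `z`
(`HasInfinityType.apply_infiniteIdeles_eq`: the idele `z`-at-`w` is totally positive); at `z = ζ₃`:
`1 = χ_w(ζ₃³) = χ_w(ζ₃)³ = ω_w(ζ₃) = ζ₃^{q_w - p_w}`, so `3 ∣ p_w - q_w`, hence `3 ∣ p_w, q_w`; then
`g := χ((x,1)) / A_{p',q'}(x)` is continuous near `1` with `g³ = 1` and `g(1) = 1`, so `g = 1` near `1`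
(`|ζ₃ - 1| = √3 > 1`).  Purely GL(1); size M (the `w`-slot idele API is the work). -/
def CubeRootAlgebraic : Prop :=
  ∀ (K : Type) [Field K] [NumberField K] (χ ω : HeckeCharacter K) (p q : InfinitePlace K → ℤ),
    χ ^ 3 = ω → ω.HasInfinityType p q → (∀ w : InfinitePlace K, (3 : ℤ) ∣ p w + q w) → χ.IsAlgebraic

/-- STATEMENT of `stub_purityGL3` — **Clozel's purity lemma on multisets for cuspidal regular algebraic `π`
on `GL₃`**: there is `w ∈ ℤ` with `{a at ῑ} = {w - a : a at ι}` for every embedding `ι` — VERBATIM clause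
(iii) of the named fact `Clozel1990_regularAlgebraic` (Clozel 1990, Lemme 4.9) at `n = 3`
(`purityGL3_of_Clozel` below is the one-line check).  The named fact is UNPROVED in the tree and may not be
assumed; the intended tree proof is the unitarity argument: pass to the clean cuspidal model
(`exists_clean_hasSatakeParamAt_hasArchParameter_of_sSup_irreducible`), twist so that `A_G` acts unitarily,
and apply the PROVED `HasArchParameter.map_neg_conj_of_skewHermitian` to the Petersson pairing
(`l2Pairing_lieDeriv_add_eq_zero`): `{a at ῑ} = {2y - ā : a at ι}` with `2y = a' + b ∈ ℤ` for integral
exponents — idea card `petersson-hermitian-parity` (and `RegularTwistCM/Ideas/petersson-hermitian-purity`).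
The one genuinely archimedean input of the line; size M–L.  HARDEST stub. -/
def PurityGL3 : Prop :=
  ∀ (K : Type) [Field K] [NumberField K] (h3 : isCompact_glFiniteIntegralLevel 3 K)
    (π : CuspidalAutomorphicRepData 3 K h3) (T : InfinityType K 3),
    π.1.HasInfinityType T → T.IsRegularAlgebraic →
      ∃ w : ℤ, ∀ ι : K →+* ℂ, (T (ComplexEmbedding.conjugate ι)).map ArchWeight.a =
        ((T ι).map ArchWeight.a).map fun a => (w : ℂ) - a

/-- **Stub 1 (size M)** — the central character of `π` with infinity type `T` (integral `a`-sums `A`) is an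
algebraic Hecke character of type `(-A_{ι_w}, -A_{ῑ_w})`; verbatim `CentralCharacterInfinityType`. -/
theorem stub_centralCharacterInfinityType :
    ∀ (K : Type) [Field K] [NumberField K] (n : ℕ) (hcpt : isCompact_glFiniteIntegralLevel n K)
      (π : AutomorphicRepData (AutomorphyDatum.gl n K hcpt)) (ω : HeckeCharacter K),
      (∀ (z : ideleGroup K), ∀ φ ∈ π.W, rightTranslation (AdelicGroupData.gl n K)
          (Matrix.GeneralLinearGroup.scalar (Fin n) z) φ - ((ω z : ℂˣ) : ℂ) • φ ∈ π.W') →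
      ∀ (T : InfinityType K n), π.HasInfinityType T →
      ∀ (A : (K →+* ℂ) → ℤ), (∀ ι : K →+* ℂ, ((T ι).map ArchWeight.a).sum = (A ι : ℂ)) →
        ω.HasInfinityType (fun w => -A w.embedding)
          (fun w => if w.IsReal then 0 else -A (ComplexEmbedding.conjugate w.embedding)) :=
  -- LANDED (wave 1, p76660): `Theorems/IrreducibilityBySelfDualityRegularAdjointLiftCMCentralCharacterInfinityType.lean`
  Summit.Langlands.Langlands.Theorems.RegularAdjointLiftCM.stub_centralCharacterInfinityType

/-- **Stub 2 (size M)** — a cube root of an algebraic Hecke character of weight divisible by `3` is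
algebraic; verbatim `CubeRootAlgebraic`. -/
theorem stub_cubeRootAlgebraic :
    ∀ (K : Type) [Field K] [NumberField K] (χ ω : HeckeCharacter K) (p q : InfinitePlace K → ℤ),
      χ ^ 3 = ω → ω.HasInfinityType p q → (∀ w : InfinitePlace K, (3 : ℤ) ∣ p w + q w) →
        χ.IsAlgebraic :=
  -- LANDED (wave 1, p77063): `Theorems/IrreducibilityBySelfDualityRegularAdjointLiftCMCubeRootAlgebraic.lean`
  Summit.Langlands.Langlands.Theorems.RegularAdjointLiftCM.stub_cubeRootAlgebraic

/-- STATEMENT of `stub_hermitianSymmetry` (RESHAPED stub 3, line lead 2026-08-16) — **the archimedean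
parameter of EVERY cuspidal datum is Hermitian-symmetric up to a real shift**: for `π` cuspidal on
`GL_n(𝔸_K)` (`n ≥ 1`, any number field, any `W'`, no algebraicity) with archimedean parameter `χ` there is
ONE real `c` with `χ(ῑ) = {-ā + c : a ∈ χ(ι)}` at every embedding `ι` — Clozel's purity lemma (Lemme 4.9)
in its weight-free form on multisets = unitarity of `π_∞ ⊗ |det|^{c/2}` read on the Harish-Chandra
parameter (Knapp–Vogan IX §1).  Tree proof (all pieces PROVED): clean model with the same parameter
(`exists_clean_hasSatakeParamAt_hasArchParameter_of_sSup_irreducible` + `stable_cuspidal_eq_sSup_irreducible_holds`),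
`A_G` acts on it by `a^μ` (`exists_apply_posRealScalar_mul_eq_cpow`), the complex twist `⊗ |det|^{-μ/(n[K:ℚ])}`
is `A_G`-invariant (`mulChar_detTwist_apply_posRealScalar_mul_of_cpow`) hence carries the Petersson form
(`l2Pairing`, `cuspidal_bounded_holds`, `l2Pairing_lieDeriv_add_eq_zero`, `eq_zero_of_l2Pairing_self_eq_zero`);
PULLED BACK along `W₀ ≃ W₀ ⊗ |det|^s` (`lieRep_mulChar_twist`, complex `s`) that form is skew for the REAL
shift `ρ₀ + re(s)·λ·1`, whose parameter is `χ + re s` (`HasHCParameter.of_twist_norm`), and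
`HasArchParameter.map_neg_conj_of_skewHermitian` gives `χ(ῑ) + re s = {-conj(a + re s)}`, i.e. `c = -2 re s`.
This is the same statement as the expired sibling-line stub `stub_hermitianPurity` (petersson-hermitian-parity)
and as `RegularTwistCM`'s `HermitianArchSymmetryCuspidal`: one proof serves both cruxes. -/
def HermitianSymmetry : Prop :=
  ∀ (n : ℕ) [NeZero n] (K : Type) [Field K] [NumberField K] (hcpt : isCompact_glFiniteIntegralLevel n K)
    (π : CuspidalAutomorphicRepData n K hcpt) (χ : (K →+* ℂ) → Multiset ℂ), π.1.HasArchParameter χ →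
      ∃ c : ℝ, ∀ ι : K →+* ℂ,
        χ (ComplexEmbedding.conjugate ι) = (χ ι).map fun a => -(starRingEnd ℂ a) + (c : ℂ)

/-- **Stub 3 (RESHAPED; size M–L, hardest, held by the line lead)** — Hermitian symmetry of the archimedean
parameter of a cuspidal datum; verbatim `HermitianSymmetry`.  (`PurityGL3` follows by the proved glue
`purityGL3_of_hermitianSymmetry` below.) [cite: Clozel1990, Lemme 4.9] [cite: KnappVogan1995, Ch. IX §1 (p. 597)] -/
theorem stub_hermitianSymmetry :
    ∀ (n : ℕ) [NeZero n] (K : Type) [Field K] [NumberField K] (hcpt : isCompact_glFiniteIntegralLevel n K)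
      (π : CuspidalAutomorphicRepData n K hcpt) (χ : (K →+* ℂ) → Multiset ℂ), π.1.HasArchParameter χ →
        ∃ c : ℝ, ∀ ι : K →+* ℂ,
          χ (ComplexEmbedding.conjugate ι) = (χ ι).map fun a => -(starRingEnd ℂ a) + (c : ℂ) :=
  -- LANDED (lead, p78932 Literature `ClozelPurityProofs` + p96466 re-export):
  -- `Theorems/IrreducibilityBySelfDualityRegularAdjointLiftCMHermitianSymmetry.lean`
  Summit.Langlands.Langlands.Theorems.RegularAdjointLiftCM.stub_hermitianSymmetry

/-- **GLUE (proved): Hermitian symmetry ⇒ Clozel purity on multisets for regular algebraic types on `GL₃`.**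
For a C-algebraic `GL₃` type the `a`-exponents are integers (`(3-1)/2 = 1`), hence real, so
`-ā + c = c - a`; and `c ∈ ℤ` because `c - a` is again an exponent (at `ῑ`), for one embedding `ι₀` and one
of the three exponents at `ι₀`. -/
theorem purityGL3_of_hermitianSymmetry (hH : HermitianSymmetry) : PurityGL3 := by
  intro K _ _ h3 π T hT hreg
  haveI : NeZero (3 : ℕ) := ⟨by norm_num⟩
  obtain ⟨c, hc⟩ := hH 3 K h3 π (fun ι => (T ι).map ArchWeight.a) hT.2
  -- the exponents are integers
  have hint : ∀ ι : K →+* ℂ, ∀ x ∈ (T ι).map ArchWeight.a, ∃ k : ℤ, x = k := by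
    intro ι x hx
    obtain ⟨P, hP, rfl⟩ := Multiset.mem_map.mp hx
    obtain ⟨k, l, hk, -⟩ := hreg.1 ι P hP
    exact ⟨k + 1, by rw [hk]; push_cast; ring⟩
  -- `c` is an integer: read it at one embedding and one exponent
  obtain ⟨ι₀⟩ : Nonempty (K →+* ℂ) := ⟨(Classical.arbitrary (InfinitePlace K)).embedding⟩
  have hcard : Multiset.card ((T ι₀).map ArchWeight.a) = 3 := by rw [Multiset.card_map, hT.1.1 ι₀]
  obtain ⟨a₀, ha₀⟩ : ∃ a, a ∈ (T ι₀).map ArchWeight.a :=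
    Multiset.card_pos_iff_exists_mem.mp (by rw [hcard]; norm_num)
  obtain ⟨k₀, hk₀⟩ := hint ι₀ a₀ ha₀
  have hmem : -(starRingEnd ℂ a₀) + (c : ℂ) ∈ (T (ComplexEmbedding.conjugate ι₀)).map ArchWeight.a := by
    rw [hc ι₀]
    exact Multiset.mem_map_of_mem _ ha₀
  obtain ⟨m₀, hm₀⟩ := hint _ _ hmem
  have hcZ : (c : ℂ) = ((m₀ + k₀ : ℤ) : ℂ) := by
    rw [hk₀, map_intCast] at hm₀
    push_cast
    linear_combination hm₀
  refine ⟨m₀ + k₀, fun ι => ?_⟩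
  rw [hc ι]
  refine Multiset.map_congr rfl fun x hx => ?_
  obtain ⟨k, rfl⟩ := hint ι x hx
  rw [map_intCast, hcZ]
  ring

/-- **`PurityGL3` from the reshaped stub** (the statement the composition consumes). -/
theorem purityGL3_holds : PurityGL3 := purityGL3_of_hermitianSymmetry stub_hermitianSymmetry

/-! ## §2 The Satake half (PROVED): `θ_ν³ = ω_π` -/

section Satake

variable {K : Type} [Field K] [NumberField K] {h1 : isCompact_glFiniteIntegralLevel 1 K}
  {h2 : isCompact_glFiniteIntegralLevel 2 K} {h3 : isCompact_glFiniteIntegralLevel 3 K}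

/-- **`ν³ = ω_π` as Hecke characters.**  If `t_π = d_v · Ad(t_σ)` a.e. (`AdRel`), `ω_π` carries the Satake
shadow of the central character of `π` (`ω_π(ϖ_v) = ∏ t_{π,v}`, `AutomorphicRepData.exists_centralCharacter`)
and `θ` is the Hecke character of the GL(1) datum `ν` (`d_v = θ(ϖ_v)`), then `θ³ = ω_π`: at almost every
`v`, `∏ (d_v · Ad{x, y}) = d_v³` (`prod_adParams_twist_pair`), and Hecke characters agreeing at almost all
uniformizers are equal (`HeckeCharacter.ext_of_eventually_valueAtUniformizer_eq`). -/
theorem pow_three_eq_centralCharacter {π : CuspidalAutomorphicRepData 3 K h3}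
    {σ : CuspidalAutomorphicRepData 2 K h2} {ν : CuspidalAutomorphicRepData 1 K h1}
    {ωπ θ : HeckeCharacter K} (had : AdRel π σ ν)
    (hω : ∀ {v : HeightOneSpectrum (𝓞 K)} {α : Multiset ℂ}, π.1.HasSatakeParamAt v α →
      ωπ.IsUnramifiedAt v ∧ ωπ.valueAtUniformizer v = α.prod)
    (hθ : ∀ (v : HeightOneSpectrum (𝓞 K)) (d : ℂ), ν.1.HasSatakeParamAt v {d} →
      d = θ.valueAtUniformizer v) :
    θ ^ 3 = ωπ := by
  refine HeckeCharacter.ext_of_eventually_valueAtUniformizer_eq ?_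
  filter_upwards [had, π.1.hasSatakeParamAt_cofinite_holds, σ.1.hasSatakeParamAt_cofinite_holds]
    with v hv hπu hσu
  obtain ⟨α, hα⟩ := hπu
  obtain ⟨β, hβ⟩ := hσu
  obtain ⟨d, hd, hαd⟩ := hv α β hα hβ
  obtain ⟨-, hωv⟩ := hω hα
  have h0 := hβ.zero_not_mem
  obtain ⟨x, y, rfl⟩ := Multiset.card_eq_two.mp hβ.card_eq
  have hx : x ≠ 0 := fun h => h0 (by simp [h])
  have hy : y ≠ 0 := fun h => h0 (by simp [h])
  have hprod : α.prod = d ^ 3 := by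
    rw [hαd]
    exact prod_adParams_twist_pair d hx hy
  rw [hωv, hprod, hθ v d hd]
  simp only [HeckeCharacter.valueAtUniformizer, HeckeCharacter.localComponent_apply,
    HeckeCharacter.pow_apply, Units.val_pow_eq_pow_val]

/-- **GL(1) dictionary, pointwise, for THE Hecke character of `ν`** (the one through which `GL₁(𝔸_K)` acts
on `W/W'`): its values at uniformizers are the Satake values of `ν` (tree lemmas
`isUnramifiedAt_heckeCharacter_glOne`, `exists_eq_singleton_of_hasSatakeParamAt_glOne`,
`localComponent_eq_valueAtUniformizer`; cf. `Negative/KillCriterion.exists_heckeCharacter_satake_eq`). -/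
theorem satake_eq_valueAtUniformizer (ν : CuspidalAutomorphicRepData 1 K h1) {θ : HeckeCharacter K}
    (hθ : ∀ (g : (AdelicGroupData.gl 1 K).Adelic), ∀ φ ∈ ν.1.W,
      rightTranslation (AdelicGroupData.gl 1 K) g φ -
        ((θ (Matrix.GeneralLinearGroup.det g) : ℂˣ) : ℂ) • φ ∈ ν.1.W')
    (v : HeightOneSpectrum (𝓞 K)) (d : ℂ) (hd : ν.1.HasSatakeParamAt v {d}) :
    d = θ.valueAtUniformizer v := by
  have hur : θ.IsUnramifiedAt v := ν.1.isUnramifiedAt_heckeCharacter_glOne hθ hd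
  obtain ⟨ϖ, hϖ, hdϖ⟩ := ν.1.exists_eq_singleton_of_hasSatakeParamAt_glOne hθ hd
  rw [Multiset.singleton_inj.mp hdϖ, ← HeckeCharacter.localComponent_apply,
    HeckeCharacter.localComponent_eq_valueAtUniformizer hur hϖ]

end Satake

/-! ## §3 Arithmetic of infinity types (PROVED helpers) -/

section Arithmetic

variable {K : Type} [Field K]

/-- A multiset of weights with integral `a`-exponents has an integral `a`-sum. -/
theorem exists_intCast_eq_sum_a {s : Multiset ArchWeight} (h : ∀ P ∈ s, ∃ k : ℤ, P.a = k) :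
    ∃ k : ℤ, (s.map ArchWeight.a).sum = k := by
  induction s using Multiset.induction_on with
  | empty => exact ⟨0, by simp⟩
  | cons P s ih =>
      obtain ⟨k, hk⟩ := h P (Multiset.mem_cons_self P s)
      obtain ⟨l, hl⟩ := ih fun Q hQ => h Q (Multiset.mem_cons_of_mem hQ)
      exact ⟨k + l, by rw [Multiset.map_cons, Multiset.sum_cons, hk, hl]; push_cast; ring⟩

/-- **For `GL₃`, a C-algebraic infinity type has integral exponents** (`(3-1)/2 = 1`), hence integral
`a`-sums `A ι`. -/
theorem exists_sum_a_eq_intCast_of_isCAlgebraic_three {T : InfinityType K 3} (hC : T.IsCAlgebraic) :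
    ∃ A : (K →+* ℂ) → ℤ, ∀ ι : K →+* ℂ, ((T ι).map ArchWeight.a).sum = (A ι : ℂ) := by
  have h : ∀ ι : K →+* ℂ, ∃ k : ℤ, ((T ι).map ArchWeight.a).sum = k := fun ι =>
    exists_intCast_eq_sum_a fun P hP => by
      obtain ⟨k, l, hk, -⟩ := hC ι P hP
      exact ⟨k + 1, by rw [hk]; push_cast; ring⟩
  choose A hA using h
  exact ⟨A, hA⟩

/-- `∑ (w - a) = |s| w - ∑ a`. -/
theorem sum_map_intCast_sub (s : Multiset ℂ) (w : ℤ) :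
    (s.map fun a => (w : ℂ) - a).sum = (Multiset.card s : ℂ) * w - s.sum := by
  induction s using Multiset.induction_on with
  | empty => simp
  | cons a s ih =>
      rw [Multiset.map_cons, Multiset.sum_cons, Multiset.sum_cons, Multiset.card_cons, ih]
      push_cast
      ring

/-- **Purity on multisets ⇒ purity of the `a`-sums**: `A_{ῑ} = 3w - A_ι` for a well-formed `GL₃` type. -/
theorem sum_a_conjugate_eq {T : InfinityType K 3} (hwf : T.IsWellFormed) {A : (K →+* ℂ) → ℤ}
    (hA : ∀ ι : K →+* ℂ, ((T ι).map ArchWeight.a).sum = (A ι : ℂ)) {w : ℤ}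
    (hw : ∀ ι : K →+* ℂ, (T (ComplexEmbedding.conjugate ι)).map ArchWeight.a =
      ((T ι).map ArchWeight.a).map fun a => (w : ℂ) - a) (ι : K →+* ℂ) :
    A (ComplexEmbedding.conjugate ι) = 3 * w - A ι := by
  have h1 := congrArg Multiset.sum (hw ι)
  rw [hA, sum_map_intCast_sub, hA, Multiset.card_map, hwf.1 ι] at h1
  exact_mod_cast h1

/-- **The divisibility fed to the cube-root stub**: with `p_w = -A_{ι_w}`, `q_w = -A_{ῑ_w}` (`0` at a real
`w`), purity gives `3 ∣ p_w + q_w` (complex `w`: `p + q = -3w₀`; real `w`: `ῑ_w = ι_w`, `2A = 3w₀`). -/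
theorem three_dvd_of_purity {T : InfinityType K 3} (hwf : T.IsWellFormed) {A : (K →+* ℂ) → ℤ}
    (hA : ∀ ι : K →+* ℂ, ((T ι).map ArchWeight.a).sum = (A ι : ℂ)) {w₀ : ℤ}
    (hw : ∀ ι : K →+* ℂ, (T (ComplexEmbedding.conjugate ι)).map ArchWeight.a =
      ((T ι).map ArchWeight.a).map fun a => (w₀ : ℂ) - a) (w : InfinitePlace K) :
    (3 : ℤ) ∣ (fun w : InfinitePlace K => -A w.embedding) w +
      (fun w : InfinitePlace K => if w.IsReal then 0 else -A (ComplexEmbedding.conjugate w.embedding)) w := by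
  have h2 := sum_a_conjugate_eq hwf hA hw w.embedding
  by_cases hr : w.IsReal
  · have hc : ComplexEmbedding.conjugate w.embedding = w.embedding :=
      ComplexEmbedding.isReal_iff.mp (InfinitePlace.isReal_iff.mp hr)
    rw [hc] at h2
    simp only [if_pos hr]
    omega
  · simp only [if_neg hr]
    omega

end Arithmetic

/-! ## §4 GL(1): an algebraic Hecke character gives a regular algebraic datum (PROVED) -/

section GLOne

variable {K : Type} [Field K] [NumberField K] {h1 : isCompact_glFiniteIntegralLevel 1 K}

/-- **A `GL₁` datum whose Hecke character has an infinity type is regular algebraic**: by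
`exists_hasInfinityType_of_hasInfinityType_heckeCharacter_glOne` it has a (well-formed) infinity type with
`a`-multisets `{-n_ι}`; its `b`-exponents are the `a`-exponents at `ῑ` (well-formedness), all integers, and
a singleton is `Nodup`.  Clozel's dictionary for `n = 1`. [cite: Clozel1990, §1.1 and Déf. 1.8] -/
theorem isRegularAlgebraic_glOne_of_hasInfinityType (ν : AutomorphicRepData (AutomorphyDatum.gl 1 K h1))
    {θ : HeckeCharacter K}
    (hθ : ∀ (g : (AdelicGroupData.gl 1 K).Adelic), ∀ φ ∈ ν.W,
      rightTranslation (AdelicGroupData.gl 1 K) g φ -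
        ((θ (Matrix.GeneralLinearGroup.det g) : ℂˣ) : ℂ) • φ ∈ ν.W')
    {p q : InfinitePlace K → ℤ} (hpq : θ.HasInfinityType p q) : ν.IsRegularAlgebraic := by
  obtain ⟨T, hT, ha⟩ := ν.exists_hasInfinityType_of_hasInfinityType_heckeCharacter_glOne hθ hpq
  refine ⟨T, hT, ?_, ?_⟩
  · intro ι P hP
    have haP : P.a ∈ (T ι).map ArchWeight.a := Multiset.mem_map_of_mem _ hP
    rw [ha ι, Multiset.mem_singleton] at haP
    have hsw : P.swap ∈ T (ComplexEmbedding.conjugate ι) := by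
      rw [hT.1.2 ι]
      exact Multiset.mem_map_of_mem _ hP
    have hbP : P.swap.a ∈ (T (ComplexEmbedding.conjugate ι)).map ArchWeight.a :=
      Multiset.mem_map_of_mem _ hsw
    rw [ha, Multiset.mem_singleton, ArchWeight.swap_a] at hbP
    refine ⟨-HeckeCharacter.embExponent p q ι,
      -HeckeCharacter.embExponent p q (ComplexEmbedding.conjugate ι), ?_, ?_⟩
    · rw [haP]; push_cast; ring
    · rw [hbP]; push_cast; ring
  · intro ι
    rw [ha ι]
    exact Multiset.nodup_singleton _

end GLOne

/-! ## §5 The composition (kernel-checked) -/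

/-- **Hypothesis form of the line**: the three stub statements imply `NuAlgebraic` (any number field). -/
theorem nuAlgebraic_of (hC : CentralCharacterInfinityType) (hR : CubeRootAlgebraic) (hP : PurityGL3) :
    NuAlgebraic := by
  intro K _ _ h1 h2 h3 π σ ν hπ had
  -- the central character of `π` and the Hecke character of `ν`
  obtain ⟨ωπ, hωW, hωsat⟩ := π.1.exists_centralCharacter
  obtain ⟨θ, hθW⟩ := ν.1.exists_heckeCharacter_glOne
  -- Satake half: `θ³ = ω_π`
  have hcube : θ ^ 3 = ωπ :=
    pow_three_eq_centralCharacter had (fun hα => hωsat hα) (satake_eq_valueAtUniformizer ν hθW)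
  -- the infinity type of `π`, its integral `a`-sums, and the infinity type of `ω_π`
  obtain ⟨T, hT, hTreg⟩ := hπ
  obtain ⟨A, hA⟩ := exists_sum_a_eq_intCast_of_isCAlgebraic_three hTreg.1
  have hωtype := hC K 3 h3 π.1 ωπ hωW T hT A hA
  -- purity ⇒ `3 ∣ p_w + q_w`
  obtain ⟨w₀, hw₀⟩ := hP K h3 π T hT hTreg
  have hdiv := three_dvd_of_purity hT.1 hA hw₀
  -- cube root ⇒ `θ` algebraic ⇒ `ν` regular algebraic
  obtain ⟨p', q', hθtype⟩ :=
    (θ.isAlgebraic_iff_exists_hasInfinityType).1 (hR K θ ωπ _ _ hcube hωtype hdiv)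
  exact isRegularAlgebraic_glOne_of_hasInfinityType ν.1 hθW hθtype

/-- **The line's target, from the stubs**: `ν` is algebraic (any field). -/
theorem nuAlgebraic : NuAlgebraic :=
  nuAlgebraic_of stub_centralCharacterInfinityType stub_cubeRootAlgebraic purityGL3_holds

/-- The Disproof's `NuAlgebraicInput` (CM form), from the stubs. -/
theorem nuAlgebraicInput : NuAlgebraicInput :=
  nuAlgebraicInput_of_nuAlgebraic nuAlgebraic

section Twist

variable {K : Type} [Field K] [NumberField K] {h1 : isCompact_glFiniteIntegralLevel 1 K}
  {h2 : isCompact_glFiniteIntegralLevel 2 K} {h3 : isCompact_glFiniteIntegralLevel 3 K}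

/-- Rankin–Selberg data are blind to a common twist: `{(ca)(cb)⁻¹} = {ab⁻¹}` (`c ≠ 0`) (Disproof §3 /
`Negative/KillCriterion`, re-proved). -/
theorem rsData_map_mul (s t : Multiset ℂ) {c : ℂ} (hc : c ≠ 0) :
    rsData (s.map (c * ·)) (t.map (c * ·)) = rsData s t := by
  induction s using Multiset.induction_on with
  | empty => simp [rsData_zero]
  | cons a s ih =>
      rw [Multiset.map_cons, rsData_cons, rsData_cons, ih, Multiset.map_map]
      congr 1
      refine Multiset.map_congr rfl fun y _ => ?_
      simp only [Function.comp_apply]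
      rw [mul_inv, mul_mul_mul_comm, mul_inv_cancel₀ hc, one_mul]

/-- **`Ad` is twist-invariant**: `Ad(c · β) = Ad(β)` for `c ≠ 0` (Disproof §3 / `Negative/KillCriterion`,
re-proved). -/
theorem adParams_map_mul (β : Multiset ℂ) {c : ℂ} (hc : c ≠ 0) :
    adParams (β.map (c * ·)) = adParams β := by
  change (rsData _ _).erase 1 = (rsData _ _).erase 1
  rw [rsData_map_mul β β hc]

/-- A GL(1) Satake value is non-zero. -/
theorem ne_zero_of_hasSatakeParamAt_singleton {χ : CuspidalAutomorphicRepData 1 K h1}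
    {v : HeightOneSpectrum (𝓞 K)} {c : ℂ} (h : χ.1.HasSatakeParamAt v {c}) : c ≠ 0 :=
  fun h0 => h.zero_not_mem (by simp [h0])

/-- **`AdRel` is invariant under a.e. Satake twists of `σ`** (Disproof §3, re-proved: Satake uniqueness,
a.e. unramifiedness of `σ₀`, `adParams_map_mul`). -/
theorem adRel_of_isSatakeTwistOf {π : CuspidalAutomorphicRepData 3 K h3}
    {σ σ₀ : CuspidalAutomorphicRepData 2 K h2} {ν χ : CuspidalAutomorphicRepData 1 K h1}
    (h : AdRel π σ₀ ν) (htw : IsSatakeTwistOf σ σ₀ χ) : AdRel π σ ν := by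
  have hcof : ∀ᶠ v in cofinite, σ₀.1.IsUnramifiedAt v := σ₀.1.hasSatakeParamAt_cofinite_holds
  filter_upwards [h, htw, hcof] with v hv htv hur α β hα hβ
  obtain ⟨β₀, hβ₀⟩ := hur
  obtain ⟨c, hc, hσ⟩ := htv β₀ hβ₀
  have hββ : β = β₀.map (c * ·) := σ.1.hasSatakeParamAt_unique_holds hβ hσ
  obtain ⟨d, hd, hαd⟩ := hv α β₀ hα hβ₀
  refine ⟨d, hd, ?_⟩
  have key : adParams (β₀.map (c * ·)) = adParams β₀ :=
    adParams_map_mul β₀ (ne_zero_of_hasSatakeParamAt_singleton hc)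
  change α = (adParams β).map (fun c => d * c)
  rw [hββ, key]
  exact hαd

/-- **Non-dihedrality is invariant under a.e. Satake twists** (Disproof §3, re-proved). -/
theorem nonDihedral_of_isSatakeTwistOf {σ σ₀ : CuspidalAutomorphicRepData 2 K h2}
    {χ : CuspidalAutomorphicRepData 1 K h1} (h : NonDihedral σ₀) (htw : IsSatakeTwistOf σ σ₀ χ) :
    NonDihedral σ := by
  intro L _ _ _ hL hdi
  refine h L hL ?_
  filter_upwards [hdi, htw] with v hv htv β₀ hβ₀
  obtain ⟨c, hc, hσ⟩ := htv β₀ hβ₀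
  have hc0 : c ≠ 0 := ne_zero_of_hasSatakeParamAt_singleton hc
  have key := hv (β₀.map (c * ·)) hσ
  rw [Multiset.map_map] at key
  have key' : (β₀.map fun b => quadSign L v * b).map (c * ·) = β₀.map (c * ·) := by
    rw [Multiset.map_map]
    refine Eq.trans (Multiset.map_congr rfl fun b _ => ?_) key
    simp only [Function.comp_apply]
    ring
  exact Multiset.map_injective (mul_right_injective₀ hc0) key'

end Twist

/-- **THE SKELETON THEOREM.**  The crux `RegularAdjointLiftCM`, BY NAME, from the sibling route item
`RegularTwistCM` (hypothesis by name) and the three stubs (through `nuAlgebraicInput`): the composition of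
Disproof §3 `cmStep_of_regularTwistCM` — Thm A (the crux's inlined antecedent `hA`) gives `(σ₀, ν)`
non-dihedral with `AdRel π σ₀ ν` (Satake uniqueness), `RegularTwistCM` re-twists `σ₀ ↦ σ` regular
algebraic, `AdRel`/`NonDihedral` transport along the twist, and `ν` is algebraic by `nuAlgebraicInput`. -/
theorem RegularAdjointLiftCM_of
    (hT : Summit.Langlands.Langlands.Theses.IrreducibilityBySelfDuality.RegularTwistCM) :
    Summit.Langlands.Langlands.Theses.IrreducibilityBySelfDuality.RegularAdjointLiftCM := by
  intro hA K _ _ hK h1 h2 h3 π hπ hη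
  obtain ⟨η, hη⟩ := hη
  obtain ⟨σ₀, ν, hnd, hrel⟩ := hA K h1 h2 h3 π η hη
  have had : AdRel π σ₀ ν := by
    filter_upwards [hrel] with v hv α β hα hβ
    obtain ⟨d, e, hd, -, -, hP⟩ := hv β hβ
    exact ⟨d, hd, π.1.hasSatakeParamAt_unique_holds hα hP⟩
  obtain ⟨σ, χ, hσ, htw⟩ := hT K hK h1 h2 h3 π σ₀ ν hπ had
  exact ⟨σ, ν, hσ, nuAlgebraicInput K hK h1 h2 h3 π σ₀ ν hπ had,
    nonDihedral_of_isSatakeTwistOf (h2 := h2) (σ₀ := σ₀) hnd htw, adRel_of_isSatakeTwistOf had htw⟩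

end Summit.Langlands.Langlands.Cruxes.RegularAdjointLiftCM.NuCubedCentralCharacter

end
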